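import Summits.QuantumFields.YangMills.Theorems.ColdStartUniversalityLatticeLangevinDuhamelSecondForm
import HarnessLib

/-!
# Route `ColdStartUniversality` (fixed-cut-off package): SYMMETRY of a ground-state Duhamel perturbation of a symmetric
# Markov semigroup — the abstract reversibility theorem

Helper file (seat `ym-line-csu-p1`, g15).  ABSTRACT measure theory on a compact space `X`, no SZZ object; step 3 of 3.
Data: Markov kernel families `κ` (dynamics) and `κ⁰` (reference) with jointly continuous actions, a finite measure `π`
for which every `κ⁰_a` is SYMMETRIC on continuous observables (`∫ F · κ⁰_a G dπ = ∫ G · κ⁰_a F dπ`), a continuous ground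
state `φ > 0`, a continuous potential `V`, and the first Duhamel form (D1) `q_t w = φ T_t w - ∫₀ᵗ q_s (V T_{t-s} w) ds` for
all continuous `w` (`q_a u = κ_a (φ u)`, `T_a = κ⁰_a`).  CONCLUSION (`integral_mul_kernel_symm_of_duhamel`): every `κ_t` is
symmetric with respect to the measure `φ⁻² π`,

  `∫ F(x) (κ_t G)(x) φ(x)⁻² dπ = ∫ G(x) (κ_t F)(x) φ(x)⁻² dπ`     (continuous `F, G`).

Proof (bilinear Grönwall): with `Q_t = φ⁻¹ q_t` and `Δ_t(f, g) := ⟨f, Q_t g⟩_π - ⟨Q_t f, g⟩_π`, pairing the SECOND form (D2,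
`duhamel_second`) for `g` and the FIRST form for `f` against `π`, exchanging `dπ` with `ds` and using the symmetry of `κ⁰`
gives `Δ_t(f, g) = -∫₀ᵗ Δ_s(V T_{t-s} f, g) ds`; with the a-priori bound `|Δ_s(f, g)| ≤ M ‖f‖ ‖g‖` this forces
`|Δ_t| ≤ M ‖f‖ ‖g‖ (K t)ⁿ/n!` for every `n`, i.e. `Δ ≡ 0`.  For the SU(2) SZZ system (`…LatticeLangevinWilsonReversible`) this is
the DETAILED-BALANCE / reversibility statement «`P_t^L` is `μ`-symmetric» of SZZ §3 (CMP 400 (2023), p. 13), there asserted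
via the Dirichlet form `𝓔^L` without proof.  No definition, no sorry.  RECORD-rung R3 plumbing (fixed cut-off); nothing here
bears on the Yang–Mills mass gap.
-/

set_option autoImplicit false

noncomputable section

namespace Summit.QuantumFields.YangMills.Theorems.ColdStartUniversality

open MeasureTheory ProbabilityTheory Filter Topology Set
open scoped NNReal

variable {X : Type*} [TopologicalSpace X] [CompactSpace X] [MeasurableSpace X] [BorelSpace X]

/-- A parametric integral `s ↦ ∫ F s x dπ(x)` of a jointly continuous `F : ℝ × X → ℝ` against a finite measure on a compact
space is continuous. [folklore] -/
theorem continuous_integral_of_continuous_uncurry (π : Measure X) [IsFiniteMeasure π] {F : ℝ → X → ℝ}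
    (hF : Continuous (Function.uncurry F)) : Continuous fun s => ∫ x, F s x ∂π := by
  have h := continuous_parametric_integral_of_continuous (μ := π) hF isCompact_univ
  simpa only [Measure.restrict_univ] using h

/-- **Symmetry of the perturbed semigroup with respect to `φ⁻² π`.**  See the module docstring. [folklore] -/
theorem integral_mul_kernel_symm_of_duhamel (κ κ₀ : ℝ≥0 → Kernel X X) [∀ t, IsMarkovKernel (κ t)]
    [∀ t, IsMarkovKernel (κ₀ t)]
    (hK : ∀ G : X → ℝ, Continuous G → Continuous fun p : ℝ≥0 × X => ∫ y, G y ∂(κ p.1 p.2))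
    (hT : ∀ G : X → ℝ, Continuous G → Continuous fun p : ℝ≥0 × X => ∫ y, G y ∂(κ₀ p.1 p.2))
    (π : Measure X) [IsFiniteMeasure π]
    (h0symm : ∀ (a : ℝ≥0) (F G : X → ℝ), Continuous F → Continuous G →
      ∫ x, F x * ∫ y, G y ∂(κ₀ a x) ∂π = ∫ x, G x * ∫ y, F y ∂(κ₀ a x) ∂π)
    {φ V : X → ℝ} (hφc : Continuous φ) (hφpos : ∀ x, 0 < φ x) (hVc : Continuous V)
    (hD : ∀ w : X → ℝ, Continuous w → ∀ (t : ℝ≥0) (x : X),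
      ∫ y, φ y * w y ∂(κ t x) = φ x * ∫ y, w y ∂(κ₀ t x) -
        ∫ s in (0 : ℝ)..(t : ℝ), ∫ y, φ y * (V y * ∫ z, w z ∂(κ₀ ((t : ℝ) - s).toNNReal y)) ∂(κ s.toNNReal x))
    {ρ : X → ℝ} (hρ : ∀ x, ρ x = (φ x)⁻¹ * (φ x)⁻¹)
    (t : ℝ≥0) {F G : X → ℝ} (hF : Continuous F) (hG : Continuous G) :
    ∫ x, F x * (∫ y, G y ∂(κ t x)) * ρ x ∂π = ∫ x, G x * (∫ y, F y ∂(κ t x)) * ρ x ∂π := by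
  have hφne : ∀ y, φ y ≠ 0 := fun y => (hφpos y).ne'
  have hφic : Continuous fun y => (φ y)⁻¹ := hφc.inv₀ hφne
  obtain ⟨Φ, hΦ0, hΦ⟩ := exists_abs_le_of_continuous_of_compactSpace hφc
  obtain ⟨φ₀, hφ₀, hφ₀le⟩ := exists_pos_le_of_continuous_of_compactSpace hφc hφpos
  obtain ⟨K, hK0, hKV⟩ := exists_abs_le_of_continuous_of_compactSpace hVc
  have hφi : ∀ y, |(φ y)⁻¹| ≤ φ₀⁻¹ := fun y => by
    rw [abs_inv, abs_of_pos (hφpos y)]; exact inv_anti₀ hφ₀ (hφ₀le y)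
  set Mπ : ℝ := π.real univ with hMπ
  have hMπ0 : 0 ≤ Mπ := measureReal_nonneg
  -- ### the operators in real time
  set T : ℝ → (X → ℝ) → X → ℝ := fun a u x => ∫ y, u y ∂(κ₀ a.toNNReal x) with hTdef
  set q : ℝ → (X → ℝ) → X → ℝ := fun a u x => ∫ y, φ y * u y ∂(κ a.toNNReal x) with hqdef
  -- the pairing `⟨f, Q_s g⟩_π` and the defect `Δ`
  set Pq : ℝ → (X → ℝ) → (X → ℝ) → ℝ := fun a f g => ∫ x, f x * (φ x)⁻¹ * q a g x ∂π with hPqdef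
  set Δ : ℝ → (X → ℝ) → (X → ℝ) → ℝ := fun a f g => Pq a f g - Pq a g f with hΔdef
  -- ### continuity of the actions on families, bounds
  have hTfam : ∀ {P : Type} [TopologicalSpace P] {u : P → X → ℝ}, Continuous (Function.uncurry u) →
      ∀ {τ : P → ℝ}, Continuous τ → Continuous fun r : P × X => T (τ r.1) (u r.1) r.2 :=
    fun hu _ hτ => continuous_refAction_family κ₀ hT hu hτ
  have hqfam : ∀ {P : Type} [TopologicalSpace P] {u : P → X → ℝ}, Continuous (Function.uncurry u) →
      ∀ {τ : P → ℝ}, Continuous τ → Continuous fun r : P × X => q (τ r.1) (u r.1) r.2 :=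
    fun hu _ hτ => continuous_gsAction_family κ hK hφc hu hτ
  have hTc : ∀ (a : ℝ) {u : X → ℝ}, Continuous u → Continuous (T a u) := fun a u hu =>
    continuous_refAction κ₀ hT hu a
  have hqc : ∀ (a : ℝ) {u : X → ℝ}, Continuous u → Continuous (q a u) := fun a u hu =>
    continuous_gsAction κ hK hφc hu a
  have hTbd : ∀ (a : ℝ) {u : X → ℝ} {B : ℝ}, (∀ y, |u y| ≤ B) → ∀ x, |T a u x| ≤ B :=
    fun a u B hu x => abs_integral_le_of_abs_le_of_isProbabilityMeasure hu
  have hqbd : ∀ (a : ℝ) {u : X → ℝ} {B : ℝ}, 0 ≤ B → (∀ y, |u y| ≤ B) → ∀ x, |q a u x| ≤ Φ * B :=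
    fun a u B hB hu x => abs_integral_le_of_abs_le_of_isProbabilityMeasure fun y => by
      rw [abs_mul]; exact mul_le_mul (hΦ y) (hu y) (abs_nonneg _) hΦ0
  have hintπ : ∀ {u : X → ℝ}, Continuous u → Integrable u π := fun hu => integrable_of_continuous_of_compactSpace hu π
  have hbdπ : ∀ {u : X → ℝ} {B : ℝ}, Continuous u → (∀ x, |u x| ≤ B) → |∫ x, u x ∂π| ≤ Mπ * B := by
    intro u B hu hub
    have h := norm_integral_le_of_norm_le_const (μ := π) (f := u) (C := B)
      (Eventually.of_forall fun y => by rw [Real.norm_eq_abs]; exact hub y)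
    rw [Real.norm_eq_abs] at h
    calc |∫ x, u x ∂π| ≤ B * π.real univ := h
      _ = Mπ * B := by rw [hMπ, mul_comm]
  -- a-priori bound of the pairing and of the defect
  have hPqbd : ∀ (a : ℝ) {f g : X → ℝ}, Continuous f → Continuous g → ∀ {Bf Bg : ℝ}, 0 ≤ Bf → 0 ≤ Bg →
      (∀ y, |f y| ≤ Bf) → (∀ y, |g y| ≤ Bg) → |Pq a f g| ≤ Mπ * (Bf * φ₀⁻¹ * (Φ * Bg)) := by
    intro a f g hf hg Bf Bg hBf hBg hfb hgb
    refine hbdπ ((hf.mul hφic).mul (hqc a hg)) fun x => ?_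
    rw [abs_mul, abs_mul]
    exact mul_le_mul (mul_le_mul (hfb x) (hφi x) (abs_nonneg _) hBf) (hqbd a hBg hgb x) (abs_nonneg _) (by positivity)
  set M : ℝ := 2 * Mπ * φ₀⁻¹ * Φ with hM
  have hΔbd : ∀ (a : ℝ) {f g : X → ℝ}, Continuous f → Continuous g → ∀ {Bf Bg : ℝ}, 0 ≤ Bf → 0 ≤ Bg →
      (∀ y, |f y| ≤ Bf) → (∀ y, |g y| ≤ Bg) → |Δ a f g| ≤ M * Bf * Bg := by
    intro a f g hf hg Bf Bg hBf hBg hfb hgb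
    calc |Δ a f g| = |Pq a f g - Pq a g f| := rfl
      _ ≤ |Pq a f g| + |Pq a g f| := abs_sub _ _
      _ ≤ Mπ * (Bf * φ₀⁻¹ * (Φ * Bg)) + Mπ * (Bg * φ₀⁻¹ * (Φ * Bf)) :=
          add_le_add (hPqbd a hf hg hBf hBg hfb hgb) (hPqbd a hg hf hBg hBf hgb hfb)
      _ = M * Bf * Bg := by rw [hM]; ring
  -- ### (D1) and (D2) in real time
  have hD1 : ∀ {u : X → ℝ}, Continuous u → ∀ {r : ℝ}, 0 ≤ r → ∀ x,
      q r u x = φ x * T r u x - ∫ s in (0 : ℝ)..r, q s (fun y => V y * T (r - s) u y) x := by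
    intro u hu r hr x
    have h := hD u hu r.toNNReal x
    rw [Real.coe_toNNReal r hr] at h
    exact h
  have hD2 : ∀ {u : X → ℝ}, Continuous u → ∀ {r : ℝ}, 0 ≤ r → ∀ x,
      q r u x = φ x * T r u x - φ x * ∫ s in (0 : ℝ)..r, T (r - s) (fun y => V y * (φ y)⁻¹ * q s u y) x := by
    intro u hu r hr x
    have h := duhamel_second κ κ₀ hK hT hφc hφpos hVc hD hu r.toNNReal x
    rw [Real.coe_toNNReal r hr] at h
    exact h
  -- ### the recursion `Δ_r(f, g) = -∫₀ʳ Δ_s(V T_{r-s} f, g) ds`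
  have hrec : ∀ {f g : X → ℝ}, Continuous f → Continuous g → ∀ {r : ℝ}, 0 ≤ r →
      Δ r f g = -∫ s in (0 : ℝ)..r, Δ s (fun y => V y * T (r - s) f y) g := by
    intro f g hf hg r hr
    -- the moving observables
    have hGf : Continuous (Function.uncurry fun (s : ℝ) (y : X) => V y * T (r - s) f y) := by
      have h1 : Continuous fun p : ℝ × X => T (r - p.1) f p.2 :=
        hTfam (u := fun (_ : ℝ) (z : X) => f z) (hf.comp continuous_snd) (continuous_const.sub continuous_id)
      exact (hVc.comp continuous_snd).mul h1
    have hGfs : ∀ s, Continuous fun y => V y * T (r - s) f y := fun s => hGf.comp (continuous_const.prodMk continuous_id)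
    -- (i) `⟨f, Q_r g⟩` through (D2)
    have hA1c : Continuous (Function.uncurry fun (s : ℝ) (x : X) =>
        f x * T (r - s) (fun y => V y * (φ y)⁻¹ * q s g y) x) := by
      have hu : Continuous (Function.uncurry fun (s : ℝ) (y : X) => V y * (φ y)⁻¹ * q s g y) := by
        have hq1 : Continuous fun p : ℝ × X => q p.1 g p.2 :=
          hqfam (u := fun (_ : ℝ) (z : X) => g z) (hg.comp continuous_snd) continuous_id
        exact ((hVc.comp continuous_snd).mul (hφic.comp continuous_snd)).mul hq1
      exact (hf.comp continuous_snd).mul (hTfam hu (continuous_const.sub continuous_id))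
    have e1 : Pq r f g = (∫ x, f x * T r g x ∂π) -
        ∫ s in (0 : ℝ)..r, (∫ x, f x * T (r - s) (fun y => V y * (φ y)⁻¹ * q s g y) x ∂π) := by
      have hpt : ∀ x, f x * (φ x)⁻¹ * q r g x =
          f x * T r g x - f x * ∫ s in (0 : ℝ)..r, T (r - s) (fun y => V y * (φ y)⁻¹ * q s g y) x := by
        intro x
        have hφx : (φ x)⁻¹ * φ x = 1 := inv_mul_cancel₀ (hφne x)
        rw [hD2 hg hr x]
        have e : f x * (φ x)⁻¹ * (φ x * T r g x -
            φ x * ∫ s in (0 : ℝ)..r, T (r - s) (fun y => V y * (φ y)⁻¹ * q s g y) x) =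
            f x * ((φ x)⁻¹ * φ x) * T r g x -
              f x * ((φ x)⁻¹ * φ x) * ∫ s in (0 : ℝ)..r, T (r - s) (fun y => V y * (φ y)⁻¹ * q s g y) x := by ring
        rw [e, hφx, mul_one]
      have hA1c' : Continuous (Function.uncurry fun (x : X) (s : ℝ) =>
          f x * T (r - s) (fun y => V y * (φ y)⁻¹ * q s g y) x) := hA1c.comp continuous_swap
      have hc2 : Continuous fun x => ∫ s in (0 : ℝ)..r, f x * T (r - s) (fun y => V y * (φ y)⁻¹ * q s g y) x :=
        intervalIntegral.continuous_parametric_intervalIntegral_of_continuous' hA1c' 0 r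
      show ∫ x, f x * (φ x)⁻¹ * q r g x ∂π = _
      calc ∫ x, f x * (φ x)⁻¹ * q r g x ∂π
          = ∫ x, (f x * T r g x - ∫ s in (0 : ℝ)..r, f x * T (r - s) (fun y => V y * (φ y)⁻¹ * q s g y) x) ∂π := by
            refine integral_congr_ae (Eventually.of_forall fun x => ?_)
            beta_reduce
            rw [hpt x, intervalIntegral.integral_const_mul]
        _ = (∫ x, f x * T r g x ∂π) - ∫ x, (∫ s in (0 : ℝ)..r, f x * T (r - s) (fun y => V y * (φ y)⁻¹ * q s g y) x) ∂π :=
            integral_sub (hintπ (hf.mul (hTc r hg))) (hintπ hc2)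
        _ = _ := by rw [integral_intervalIntegral_swap_of_continuous π hA1c hr]
    -- symmetry of the reference kernels inside the time integral
    have e1' : ∀ s, ∫ x, f x * T (r - s) (fun y => V y * (φ y)⁻¹ * q s g y) x ∂π =
        ∫ x, (V x * (φ x)⁻¹ * q s g x) * T (r - s) f x ∂π := fun s =>
      h0symm (r - s).toNNReal f (fun y => V y * (φ y)⁻¹ * q s g y) hf ((hVc.mul hφic).mul (hqc s hg))
    have e0 : ∫ x, f x * T r g x ∂π = ∫ x, g x * T r f x ∂π := h0symm r.toNNReal f g hf hg
    -- (ii) `⟨Q_r f, g⟩` through (D1)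
    have hA2c : Continuous (Function.uncurry fun (s : ℝ) (x : X) =>
        g x * (φ x)⁻¹ * q s (fun y => V y * T (r - s) f y) x) :=
      ((hg.comp continuous_snd).mul (hφic.comp continuous_snd)).mul (hqfam hGf continuous_id)
    have e2 : Pq r g f = (∫ x, g x * T r f x ∂π) -
        ∫ s in (0 : ℝ)..r, (∫ x, g x * (φ x)⁻¹ * q s (fun y => V y * T (r - s) f y) x ∂π) := by
      have hpt : ∀ x, g x * (φ x)⁻¹ * q r f x =
          g x * T r f x - g x * (φ x)⁻¹ * ∫ s in (0 : ℝ)..r, q s (fun y => V y * T (r - s) f y) x := by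
        intro x
        have hφx : (φ x)⁻¹ * φ x = 1 := inv_mul_cancel₀ (hφne x)
        rw [hD1 hf hr x]
        have e : g x * (φ x)⁻¹ * (φ x * T r f x - ∫ s in (0 : ℝ)..r, q s (fun y => V y * T (r - s) f y) x) =
            g x * ((φ x)⁻¹ * φ x) * T r f x - g x * (φ x)⁻¹ * ∫ s in (0 : ℝ)..r, q s (fun y => V y * T (r - s) f y) x := by
          ring
        rw [e, hφx, mul_one]
      have hA2c' : Continuous (Function.uncurry fun (x : X) (s : ℝ) =>
          g x * (φ x)⁻¹ * q s (fun y => V y * T (r - s) f y) x) := hA2c.comp continuous_swap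
      have hc2 : Continuous fun x => ∫ s in (0 : ℝ)..r, g x * (φ x)⁻¹ * q s (fun y => V y * T (r - s) f y) x :=
        intervalIntegral.continuous_parametric_intervalIntegral_of_continuous' hA2c' 0 r
      show ∫ x, g x * (φ x)⁻¹ * q r f x ∂π = _
      calc ∫ x, g x * (φ x)⁻¹ * q r f x ∂π
          = ∫ x, (g x * T r f x - ∫ s in (0 : ℝ)..r, g x * (φ x)⁻¹ * q s (fun y => V y * T (r - s) f y) x) ∂π := by
            refine integral_congr_ae (Eventually.of_forall fun x => ?_)
            beta_reduce
            rw [hpt x, intervalIntegral.integral_const_mul]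
        _ = (∫ x, g x * T r f x ∂π) -
              ∫ x, (∫ s in (0 : ℝ)..r, g x * (φ x)⁻¹ * q s (fun y => V y * T (r - s) f y) x) ∂π :=
            integral_sub (hintπ (hg.mul (hTc r hf))) (hintπ hc2)
        _ = _ := by rw [integral_intervalIntegral_swap_of_continuous π hA2c hr]
    -- the two time integrands are continuous in `s`
    have hi1 : Continuous fun s : ℝ => ∫ x, (V x * (φ x)⁻¹ * q s g x) * T (r - s) f x ∂π := by
      refine continuous_integral_of_continuous_uncurry π ?_
      have hq1 : Continuous fun p : ℝ × X => q p.1 g p.2 :=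
        hqfam (u := fun (_ : ℝ) (z : X) => g z) (hg.comp continuous_snd) continuous_id
      have hT1 : Continuous fun p : ℝ × X => T (r - p.1) f p.2 :=
        hTfam (u := fun (_ : ℝ) (z : X) => f z) (hf.comp continuous_snd) (continuous_const.sub continuous_id)
      exact (((hVc.comp continuous_snd).mul (hφic.comp continuous_snd)).mul hq1).mul hT1
    have hi2 : Continuous fun s : ℝ => ∫ x, g x * (φ x)⁻¹ * q s (fun y => V y * T (r - s) f y) x ∂π :=
      continuous_integral_of_continuous_uncurry π hA2c
    -- the defect of the moving observable, pointwise in `s`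
    have e3 : ∀ s, Δ s (fun y => V y * T (r - s) f y) g =
        (∫ x, (V x * (φ x)⁻¹ * q s g x) * T (r - s) f x ∂π) -
          ∫ x, g x * (φ x)⁻¹ * q s (fun y => V y * T (r - s) f y) x ∂π := by
      intro s
      show (∫ x, (V x * T (r - s) f x) * (φ x)⁻¹ * q s g x ∂π) -
          ∫ x, g x * (φ x)⁻¹ * q s (fun y => V y * T (r - s) f y) x ∂π = _
      congr 1
      exact integral_congr_ae (Eventually.of_forall fun x => by ring)
    -- assemble
    show Pq r f g - Pq r g f = _
    rw [e1, e2, e0]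
    simp_rw [e1']
    rw [show -∫ s in (0 : ℝ)..r, Δ s (fun y => V y * T (r - s) f y) g =
        -∫ s in (0 : ℝ)..r, ((∫ x, (V x * (φ x)⁻¹ * q s g x) * T (r - s) f x ∂π) -
          ∫ x, g x * (φ x)⁻¹ * q s (fun y => V y * T (r - s) f y) x ∂π) from by
      congr 1; exact intervalIntegral.integral_congr fun s _ => e3 s]
    rw [intervalIntegral.integral_sub (hi1.intervalIntegrable _ _) (hi2.intervalIntegrable _ _)]
    ring
  -- ### Picard/Grönwall: `Δ ≡ 0`
  have hP : ∀ n : ℕ, ∀ {f g : X → ℝ}, Continuous f → Continuous g → ∀ {Bf Bg : ℝ}, 0 ≤ Bf → 0 ≤ Bg →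
      (∀ y, |f y| ≤ Bf) → (∀ y, |g y| ≤ Bg) → ∀ r : ℝ, 0 ≤ r → |Δ r f g| ≤ M * Bf * Bg * (K * r) ^ n / n.factorial := by
    intro n
    induction n with
    | zero =>
      intro f g hf hg Bf Bg hBf hBg hfb hgb r hr
      rw [pow_zero, Nat.factorial_zero, Nat.cast_one, div_one, mul_one]
      exact hΔbd r hf hg hBf hBg hfb hgb
    | succ n ih =>
      intro f g hf hg Bf Bg hBf hBg hfb hgb r hr
      rw [hrec hf hg hr, abs_neg]
      set A : ℝ := M * (K * Bf) * Bg * K ^ n / n.factorial with hA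
      have hbd : ∀ s ∈ Ioc (0 : ℝ) r, |Δ s (fun y => V y * T (r - s) f y) g| ≤ A * s ^ n := by
        intro s hs
        have hcs : Continuous fun y => V y * T (r - s) f y := hVc.mul (hTc (r - s) hf)
        have hbs : ∀ y, |V y * T (r - s) f y| ≤ K * Bf := fun y => by
          rw [abs_mul]; exact mul_le_mul (hKV y) (hTbd _ hfb y) (abs_nonneg _) hK0
        have h := ih hcs hg (by positivity) hBg hbs hgb s hs.1.le
        calc _ ≤ M * (K * Bf) * Bg * (K * s) ^ n / n.factorial := h
          _ = A * s ^ n := by rw [hA, mul_pow]; ring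
      have hIle : |∫ s in (0 : ℝ)..r, Δ s (fun y => V y * T (r - s) f y) g| ≤ ∫ s in (0 : ℝ)..r, A * s ^ n := by
        have h := intervalIntegral.norm_integral_le_of_norm_le (μ := volume) hr
          (f := fun s => Δ s (fun y => V y * T (r - s) f y) g)
          (g := fun s => A * s ^ n) (Eventually.of_forall fun s hs => by rw [Real.norm_eq_abs]; exact hbd s hs)
          ((continuous_const.mul (continuous_pow n)).intervalIntegrable _ _)
        rwa [Real.norm_eq_abs] at h
      have hIval : ∫ s in (0 : ℝ)..r, A * s ^ n = M * Bf * Bg * (K * r) ^ (n + 1) / (n + 1).factorial := by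
        rw [intervalIntegral.integral_const_mul, integral_pow, hA, Nat.factorial_succ, Nat.cast_mul, Nat.cast_add,
          Nat.cast_one, mul_pow, pow_succ, pow_succ]
        have hn : (n.factorial : ℝ) ≠ 0 := by positivity
        have hn1 : ((n : ℝ) + 1) ≠ 0 := by positivity
        field_simp
        ring
      exact hIle.trans hIval.le
  have hΔ0 : ∀ {f g : X → ℝ}, Continuous f → Continuous g → ∀ r : ℝ, 0 ≤ r → Δ r f g = 0 := by
    intro f g hf hg r hr
    obtain ⟨Bf, hBf, hfb⟩ := exists_abs_le_of_continuous_of_compactSpace hf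
    obtain ⟨Bg, hBg, hgb⟩ := exists_abs_le_of_continuous_of_compactSpace hg
    have hlim : Tendsto (fun n : ℕ => M * Bf * Bg * (K * r) ^ n / n.factorial) atTop (𝓝 0) := by
      have h := (FloorSemiring.tendsto_pow_div_factorial_atTop (K * r)).const_mul (M * Bf * Bg)
      rw [mul_zero] at h
      refine h.congr fun n => ?_
      ring
    have hle : |Δ r f g| ≤ 0 := ge_of_tendsto' hlim fun n => hP n hf hg hBf hBg hfb hgb r hr
    exact abs_eq_zero.1 (le_antisymm hle (abs_nonneg _))
  -- ### read off the symmetry for `F = φ f`, `G = φ g`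
  have ht0 : (0 : ℝ) ≤ t := t.2
  have hf : Continuous fun x => (φ x)⁻¹ * F x := hφic.mul hF
  have hg : Continuous fun x => (φ x)⁻¹ * G x := hφic.mul hG
  have h := hΔ0 hf hg (t : ℝ) ht0
  have hqG : ∀ x, q (t : ℝ) (fun y => (φ y)⁻¹ * G y) x = ∫ y, G y ∂(κ t x) := fun x => by
    show ∫ y, φ y * ((φ y)⁻¹ * G y) ∂(κ ((t : ℝ)).toNNReal x) = _
    rw [Real.toNNReal_coe]
    exact integral_congr_ae (Eventually.of_forall fun y => by
      show φ y * ((φ y)⁻¹ * G y) = G y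
      rw [mul_inv_cancel_left₀ (hφne y)])
  have hqF : ∀ x, q (t : ℝ) (fun y => (φ y)⁻¹ * F y) x = ∫ y, F y ∂(κ t x) := fun x => by
    show ∫ y, φ y * ((φ y)⁻¹ * F y) ∂(κ ((t : ℝ)).toNNReal x) = _
    rw [Real.toNNReal_coe]
    exact integral_congr_ae (Eventually.of_forall fun y => by
      show φ y * ((φ y)⁻¹ * F y) = F y
      rw [mul_inv_cancel_left₀ (hφne y)])
  have e1 : Pq (t : ℝ) (fun x => (φ x)⁻¹ * F x) (fun y => (φ y)⁻¹ * G y) = ∫ x, F x * (∫ y, G y ∂(κ t x)) * ρ x ∂π := by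
    show ∫ x, ((φ x)⁻¹ * F x) * (φ x)⁻¹ * q (t : ℝ) (fun y => (φ y)⁻¹ * G y) x ∂π = _
    exact integral_congr_ae (Eventually.of_forall fun x => by dsimp only; rw [hqG x, hρ x]; ring)
  have e2 : Pq (t : ℝ) (fun y => (φ y)⁻¹ * G y) (fun x => (φ x)⁻¹ * F x) = ∫ x, G x * (∫ y, F y ∂(κ t x)) * ρ x ∂π := by
    show ∫ x, ((φ x)⁻¹ * G x) * (φ x)⁻¹ * q (t : ℝ) (fun y => (φ y)⁻¹ * F y) x ∂π = _
    exact integral_congr_ae (Eventually.of_forall fun x => by dsimp only; rw [hqF x, hρ x]; ring)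
  have h' : Pq (t : ℝ) (fun x => (φ x)⁻¹ * F x) (fun y => (φ y)⁻¹ * G y) -
      Pq (t : ℝ) (fun y => (φ y)⁻¹ * G y) (fun x => (φ x)⁻¹ * F x) = 0 := h
  rw [e1, e2] at h'
  exact sub_eq_zero.1 h'

end Summit.QuantumFields.YangMills.Theorems.ColdStartUniversality

end
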